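import Mathlib.MeasureTheory.Integral.IntervalIntegral.FundThmCalculus
import Mathlib.Analysis.SpecialFunctions.Pow.Deriv
import Literature.NumberTheory.Sieve.RosserSieveMainTerm
import HarnessLib

/-!
# Partial summation under `Ω(κ, L)`: Iwaniec's Lemma 21 (Greaves' Lemma 4.1.2(ii))

Topic `Literature/NumberTheory/Sieve`; companion of `RosserSieveMainTerm.lean` (Iwaniec, *Rosser's
sieve*, Acta Arith. 36 (1980): Theorem 1 from the main-term estimates) and `SieveFunctions.lean`
(`HasIwaniecDimension g κ L` = Iwaniec's one-sided condition (1.3) = `Ω(κ, L)`). The one analytic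
input about the sifting density that the proof of Iwaniec's Lemma 20 (§8) uses is Lemma 21,
"which follows immediately from (1.3) by partial summation": for `B` positive, continuous and
increasing on `w ≤ x ≤ z`,
`∑_{w ≤ p < z} (ω(p)/p) (V(p)/V(z)) (log p/log z)^κ B(p)`
`  ≤ κ ∫_w^z B(x) d log log x + B(z)(κ+1)K/log w` (8.2).
Greaves, *Sieves in Number Theory*, Lemma 4.1.2(ii) is the same statement (with
`H(t) = (s/t)^κ B(x)`, `t = log D/log x`, error `(κ + 1) L H(s)/log w`) and supplies the proof
((4.1.2.4)–(4.1.2.10)): Abel summation with the tails `C(x, z) = V(P(x))/V(P(z)) − 1`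
((4.1.2.5)–(4.1.2.6), Buchstab), bounded through `Ω(κ, L)` by
`U(x) = (log z/log x)^κ (1 + L/log x) − 1` ((4.1.2.7), (4.1.2.10)), and an integration by parts.
Everything here is PROVED:

* `Abel.sum_sub_mul_eq`, `Abel.mul_add_sum_sub_mul_eq`, `Abel.sum_sub_mul_le` — discrete Abel
  summation and the resulting inequality for non-decreasing nonnegative weights and dominated tails;
* `BetaSieve.omegaTail κ L z x = U(x)`, `BetaSieve.omegaTailDeriv = u = −U'` with
  `hasDerivAt_omegaTail`, `omegaTailDeriv_nonneg`, `omegaTail_self` (`U(z) = L/log z`),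
  `omegaTail_eq` (product form), `omegaTail_sub_eq_integral` (FTC);
* `BetaSieve.vprod_natCast_sub_succ` (Buchstab step `V(P(n)) − V(P(n+1)) = [n prime] g(n) V(P(n))`),
  `BetaSieve.sum_primes_eq_sum_Ico`;
* `BetaSieve.sum_primes_le_of_monotoneOn` — the general form
  `∑_{w ≤ p < z} g(p) V(P(p)) Φ(p) ≤ V(P(z)) (Φ(z) L/log z + ∫_w^z Φ u)` for `Φ ≥ 0` continuous and
  non-decreasing on `[w, z]`;
* `BetaSieve.sum_primes_rpow_mul_le` (the bound with the exact integrals) and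
  `BetaSieve.sum_primes_rpow_mul_le'` — **Iwaniec's Lemma 21 / (8.2)** with `K = L`.

## References

* H. Iwaniec, *Rosser's sieve*, Acta Arith. 36 (1980), 171–202, §8, Lemma 21, (8.2).
  [IwaniecActaArith1980]
* G. Greaves, *Sieves in Number Theory*, Springer (2001), §4.1.2, Lemma 2 and (2.4)–(2.10); §1.3.5
  (1.3.5.3) (the condition `K ≤ 1 + L/log w`). [Greaves2001]

## Design notes

* `U` is written as `(log z)^κ ((log x)^{−κ} + L (log x)^{−κ−1}) − 1` so that its derivative is a
  sum of `rpow` terms (`omegaTail_eq` recovers the product form used with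
  `HasIwaniecDimension.vprod_le`).
* The sum over primes `w ≤ p < z` is `∑_{p ∈ primesBelow ⌈z⌉₊, w ≤ p}`; it is rewritten as a sum
  over all integers `⌈w⌉ ≤ n < ⌈z⌉` of the telescoping differences `V(P(n)) − V(P(n+1))`, so that Abel
  summation runs over consecutive integers and no enumeration of primes is needed.
* `B` is only assumed nonnegative, continuous and non-decreasing (Iwaniec: positive, continuous,
  increasing); `g` need not be multiplicative here.
-/

open Finset Set MeasureTheory intervalIntegral

noncomputable section

namespace Literature.NumberTheory.Sieve

/-! ### Abel summation against a non-decreasing weight -/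

namespace Abel

/-- Abel summation, first form:
`∑_{i ≤ k} (C_i − C_{i+1}) Φ_i = Φ_0 C_0 + ∑_{i<k} (Φ_{i+1} − Φ_i) C_{i+1} − C_{k+1} Φ_k`.
[folklore] -/
theorem sum_sub_mul_eq (C Φ : ℕ → ℝ) (k : ℕ) :
    ∑ i ∈ range (k + 1), (C i - C (i + 1)) * Φ i =
      Φ 0 * C 0 + ∑ i ∈ range k, (Φ (i + 1) - Φ i) * C (i + 1) - C (k + 1) * Φ k := by
  induction k with
  | zero => simp; ring
  | succ k ih => rw [sum_range_succ, ih, sum_range_succ]; ring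

/-- Abel summation, second form:
`Φ_0 U_0 + ∑_{i<k} (Φ_{i+1} − Φ_i) U_{i+1} = ∑_{i<k} Φ_i (U_i − U_{i+1}) + Φ_k U_k`. [folklore] -/
theorem mul_add_sum_sub_mul_eq (U Φ : ℕ → ℝ) (k : ℕ) :
    Φ 0 * U 0 + ∑ i ∈ range k, (Φ (i + 1) - Φ i) * U (i + 1) =
      ∑ i ∈ range k, Φ i * (U i - U (i + 1)) + Φ k * U k := by
  induction k with
  | zero => simp
  | succ k ih => rw [sum_range_succ, sum_range_succ]; linear_combination ih

/-- **Abel's inequality**: if `Φ_0 ≥ 0`, `Φ` is non-decreasing on `0, …, k`, the tails `C_i` are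
dominated by `U_i` for `i ≤ k` and `C_{k+1} = 0`, then
`∑_{i ≤ k} (C_i − C_{i+1}) Φ_i ≤ ∑_{i<k} Φ_i (U_i − U_{i+1}) + Φ_k U_k`. [folklore] -/
theorem sum_sub_mul_le (C U Φ : ℕ → ℝ) (k : ℕ) (hΦ0 : 0 ≤ Φ 0)
    (hmono : ∀ i < k, Φ i ≤ Φ (i + 1)) (hCU : ∀ i ≤ k, C i ≤ U i) (hend : C (k + 1) = 0) :
    ∑ i ∈ range (k + 1), (C i - C (i + 1)) * Φ i ≤
      ∑ i ∈ range k, Φ i * (U i - U (i + 1)) + Φ k * U k := by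
  rw [sum_sub_mul_eq, hend, zero_mul, sub_zero, ← mul_add_sum_sub_mul_eq]
  refine add_le_add (mul_le_mul_of_nonneg_left (hCU 0 (Nat.zero_le _)) hΦ0)
    (sum_le_sum fun i hi => ?_)
  have hi' := mem_range.mp hi
  exact mul_le_mul_of_nonneg_left (hCU (i + 1) hi') (sub_nonneg.mpr (hmono i hi'))

end Abel

/-! ### The weight `U(x) = (log z/log x)^κ (1 + L/log x) − 1` and its derivative -/

namespace BetaSieve

/-- `U(x) = (log z)^κ ((log x)^{−κ} + L (log x)^{−κ−1}) − 1 = (log z/log x)^κ (1 + L/log x) − 1`,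
the bound for the normalised tail `V(P(x))/V(P(z)) − 1` furnished by `Ω(κ, L)` (Greaves
(4.1.2.6)–(4.1.2.7) with (4.1.2.10): `C(x, z) = (log z/log x)^κ − 1 + R_z(x)`,
`R_z(x) ≤ (L/log x)(log z/log x)^κ`). [folklore] -/
def omegaTail (κ L z x : ℝ) : ℝ :=
  Real.log z ^ κ * (Real.log x ^ (-κ) + L * Real.log x ^ (-κ - 1)) - 1

/-- `u(x) = −U'(x) = (log z)^κ (κ (log x)^{−κ−1} + (κ + 1) L (log x)^{−κ−2}) / x` (`≥ 0`).
[folklore] -/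
def omegaTailDeriv (κ L z x : ℝ) : ℝ :=
  Real.log z ^ κ * (κ * Real.log x ^ (-κ - 1) + (κ + 1) * L * Real.log x ^ (-κ - 2)) / x

/-- `U' = −u` on `(1, ∞)`. [folklore] -/
theorem hasDerivAt_omegaTail (κ L z : ℝ) {x : ℝ} (hx : 1 < x) :
    HasDerivAt (omegaTail κ L z) (-omegaTailDeriv κ L z x) x := by
  have hx0 : x ≠ 0 := by positivity
  have hlog : 0 < Real.log x := Real.log_pos hx
  have h1 : HasDerivAt Real.log x⁻¹ x := Real.hasDerivAt_log hx0
  have h2 : HasDerivAt (fun y => Real.log y ^ (-κ)) (x⁻¹ * (-κ) * Real.log x ^ (-κ - 1)) x :=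
    h1.rpow_const (Or.inl hlog.ne')
  have h3 : HasDerivAt (fun y => Real.log y ^ (-κ - 1))
      (x⁻¹ * (-κ - 1) * Real.log x ^ (-κ - 1 - 1)) x :=
    h1.rpow_const (Or.inl hlog.ne')
  have h4 : HasDerivAt
      (fun y => Real.log z ^ κ * (Real.log y ^ (-κ) + L * Real.log y ^ (-κ - 1)) - 1)
      (Real.log z ^ κ * (x⁻¹ * (-κ) * Real.log x ^ (-κ - 1) +
        L * (x⁻¹ * (-κ - 1) * Real.log x ^ (-κ - 1 - 1)))) x :=
    ((h2.add (h3.const_mul L)).const_mul _).sub_const 1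
  rw [show (-κ - 1 - 1 : ℝ) = -κ - 2 by ring] at h4
  refine h4.congr_deriv ?_
  simp only [omegaTailDeriv]
  ring

/-- `u ≥ 0` on `(1, ∞)` for `κ, L ≥ 0`, `z ≥ 1`. [folklore] -/
theorem omegaTailDeriv_nonneg {κ L z x : ℝ} (hκ : 0 ≤ κ) (hL : 0 ≤ L) (hz : 1 ≤ z) (hx : 1 < x) :
    0 ≤ omegaTailDeriv κ L z x := by
  have hlog : 0 < Real.log x := Real.log_pos hx
  have hlogz : 0 ≤ Real.log z := Real.log_nonneg hz
  unfold omegaTailDeriv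
  have h1 : 0 ≤ Real.log x ^ (-κ - 1) := Real.rpow_nonneg hlog.le _
  have h2 : 0 ≤ Real.log x ^ (-κ - 2) := Real.rpow_nonneg hlog.le _
  have h3 : 0 ≤ Real.log z ^ κ := Real.rpow_nonneg hlogz _
  positivity

/-- `U(z) = L/log z` for `z > 1`. [folklore] -/
theorem omegaTail_self {κ L z : ℝ} (hz : 1 < z) : omegaTail κ L z z = L / Real.log z := by
  have hlog : 0 < Real.log z := Real.log_pos hz
  rw [omegaTail, mul_add, ← Real.rpow_add hlog, add_neg_cancel, Real.rpow_zero, mul_left_comm,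
    ← Real.rpow_add hlog, show κ + (-κ - 1) = -1 by ring, Real.rpow_neg_one]
  ring

/-- `U(x) = (log z/log x)^κ (1 + L/log x) − 1` for `x > 1`, `z ≥ 1` (the product form).
[folklore] -/
theorem omegaTail_eq {κ L z x : ℝ} (hz : 1 ≤ z) (hx : 1 < x) :
    omegaTail κ L z x = (Real.log z / Real.log x) ^ κ * (1 + L / Real.log x) - 1 := by
  have hlog : 0 < Real.log x := Real.log_pos hx
  rw [omegaTail, Real.div_rpow (Real.log_nonneg hz) hlog.le, Real.rpow_sub_one hlog.ne',
    Real.rpow_neg hlog.le]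
  field_simp

/-- `U` is continuous on `[c, d]` for `c > 1`. [folklore] -/
theorem continuousOn_omegaTail (κ L z : ℝ) {c d : ℝ} (hc : 1 < c) :
    ContinuousOn (omegaTail κ L z) (Icc c d) := fun _ hx =>
  ((hasDerivAt_omegaTail κ L z (lt_of_lt_of_le hc hx.1)).continuousAt).continuousWithinAt

/-- `u` is integrable on `[c, d]` for `1 < c ≤ d` (as the derivative of the monotone `−U`).
[folklore] -/
theorem intervalIntegrable_omegaTailDeriv {κ L z : ℝ} (hκ : 0 ≤ κ) (hL : 0 ≤ L) (hz : 1 ≤ z)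
    {c d : ℝ} (hc : 1 < c) (hcd : c ≤ d) :
    IntervalIntegrable (omegaTailDeriv κ L z) volume c d := by
  have hcont : ContinuousOn (fun x => -omegaTail κ L z x) (uIcc c d) := by
    rw [uIcc_of_le hcd]
    exact (continuousOn_omegaTail κ L z hc).neg
  refine intervalIntegrable_deriv_of_nonneg hcont (fun x hx => ?_) fun x hx => ?_
  · rw [min_eq_left hcd] at hx
    exact ((hasDerivAt_omegaTail κ L z (hc.trans hx.1)).neg).congr_deriv (neg_neg _)
  · rw [min_eq_left hcd] at hx
    exact omegaTailDeriv_nonneg hκ hL hz (hc.trans hx.1)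

/-- FTC: `U(c) − U(d) = ∫_c^d u` for `1 < c ≤ d`. [folklore] -/
theorem omegaTail_sub_eq_integral {κ L z : ℝ} (hκ : 0 ≤ κ) (hL : 0 ≤ L) (hz : 1 ≤ z) {c d : ℝ}
    (hc : 1 < c) (hcd : c ≤ d) :
    omegaTail κ L z c - omegaTail κ L z d = ∫ x in c..d, omegaTailDeriv κ L z x := by
  have hint := intervalIntegrable_omegaTailDeriv (κ := κ) (L := L) (z := z) hκ hL hz hc hcd
  have h := integral_eq_sub_of_hasDerivAt_of_le hcd (continuousOn_omegaTail κ L z hc)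
    (fun x hx => hasDerivAt_omegaTail κ L z (hc.trans hx.1)) hint.neg
  rw [intervalIntegral.integral_neg] at h
  linarith

/-! ### `V(P(n))` as a function of the integer `n` -/

variable {g : ArithmeticFunction ℝ} {κ L : ℝ}

/-- `P(n) = ∏_{q < n} q` for a natural number `n` (no ceiling). [folklore] -/
private theorem primesProdBelow_natCast'' (n : ℕ) :
    primesProdBelow (n : ℝ) = ∏ q ∈ Nat.primesBelow n, q := by
  rw [primesProdBelow, Nat.ceil_natCast]

/-- `V(P(n)) = ∏_{p < n} (1 − g(p))` for a natural number `n`. [folklore] -/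
theorem vprod_primesProdBelow_natCast (n : ℕ) :
    vprod g (primesProdBelow n) = ∏ p ∈ Nat.primesBelow n, (1 - g p) := by
  rw [vprod, primeFactors_primesProdBelow, Nat.ceil_natCast]

/-- Telescoping step (Buchstab for the products, Greaves (4.1.2.5)):
`V(P(n)) − V(P(n+1)) = g(n) V(P(n))` if `n` is prime, `0` otherwise.
[cite: Greaves2001, §4.1.2 (2.5)] -/
theorem vprod_natCast_sub_succ (n : ℕ) :
    vprod g (primesProdBelow n) - vprod g (primesProdBelow ((n + 1 : ℕ) : ℝ)) =
      if n.Prime then g n * vprod g (primesProdBelow n) else 0 := by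
  rw [vprod_primesProdBelow_natCast, vprod_primesProdBelow_natCast, Nat.primesBelow_succ]
  split_ifs with hn
  · rw [prod_insert (Nat.notMem_primesBelow n)]; ring
  · simp

/-- The sum over the primes `w ≤ p < z` as a sum over the integers `⌈w⌉ ≤ n < ⌈z⌉` of the
telescoping differences. [folklore] -/
theorem sum_primes_eq_sum_Ico (w z : ℝ) (Φ : ℝ → ℝ) :
    ∑ p ∈ Nat.primesBelow ⌈z⌉₊ with w ≤ ((p : ℕ) : ℝ), g p * vprod g (primesProdBelow p) * Φ p =
      ∑ n ∈ Finset.Ico ⌈w⌉₊ ⌈z⌉₊,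
        (vprod g (primesProdBelow n) - vprod g (primesProdBelow ((n + 1 : ℕ) : ℝ))) * Φ n := by
  classical
  simp_rw [vprod_natCast_sub_succ]
  rw [show (Finset.Ico ⌈w⌉₊ ⌈z⌉₊) = (Finset.range ⌈z⌉₊).filter (fun n => ⌈w⌉₊ ≤ n) by
    ext n; simp [Finset.mem_Ico, and_comm]]
  rw [Finset.sum_filter, Finset.sum_filter, Nat.primesBelow, Finset.sum_filter]
  refine Finset.sum_congr rfl fun n _ => ?_
  by_cases hn : n.Prime
  · simp only [hn, if_true, Nat.ceil_le]
  · simp only [hn, if_false, zero_mul, ite_self]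

/-! ### Iwaniec's Lemma 21 / Greaves' Lemma 4.1.2(ii) -/

/-- **Partial summation under `Ω(κ, L)`** (the engine of Iwaniec's Lemma 21 and Greaves' Lemma
4.1.2(ii), with the substitution `Φ(x) = h(x) = H(log D/log x)`): let `g` (any arithmetic
function) satisfy `Ω(κ, L)` with `κ ≥ 0`, let `2 ≤ w ≤ z`, and let `Φ ≥ 0` be continuous and
non-decreasing on `[w, z]`. Then
`∑_{w ≤ p < z} g(p) V(P(p)) Φ(p) ≤ V(P(z)) (Φ(z) L/log z + ∫_w^z Φ(x) u(x) dx)`,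
`u = −U'`, `U(x) = (log z/log x)^κ (1 + L/log x) − 1` (`BetaSieve.omegaTail`, `omegaTailDeriv`).
Proof as in Greaves, (4.1.2.4)–(4.1.2.9): Abel summation over the integers (`Abel.sum_sub_mul_le`)
with the tails `C(n) = V(P(n)) − V(P(z)) ≤ V(P(z)) U(n)` ((4.1.2.5)–(4.1.2.7)), then
`Φ(n)(U(n) − U(n+1)) = ∫_n^{n+1} Φ(n) u ≤ ∫_n^{n+1} Φ u` and `U(z) = L/log z`.
[cite: Greaves2001, §4.1.2 Lemma 2(ii) with (2.4)–(2.9)] -/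
theorem sum_primes_le_of_monotoneOn (hdim : HasIwaniecDimension g κ L) (hκ : 0 ≤ κ) {w z : ℝ}
    (hw : 2 ≤ w) (hwz : w ≤ z) {Φ : ℝ → ℝ} (hΦ0 : ∀ x ∈ Icc w z, 0 ≤ Φ x)
    (hΦm : MonotoneOn Φ (Icc w z)) (hΦc : ContinuousOn Φ (Icc w z)) :
    ∑ p ∈ Nat.primesBelow ⌈z⌉₊ with w ≤ ((p : ℕ) : ℝ), g p * vprod g (primesProdBelow p) * Φ p ≤
      vprod g (primesProdBelow z) *
        (Φ z * (L / Real.log z) + ∫ x in w..z, Φ x * omegaTailDeriv κ L z x) := by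
  have hL : 0 ≤ L := hdim.nonneg
  set b : ℕ := ⌈z⌉₊ with hb
  set a : ℕ := ⌈w⌉₊ with ha
  set T : ℕ → ℝ := fun n => vprod g (primesProdBelow n) with hT
  set Tz := vprod g (primesProdBelow z) with hTz
  set u := omegaTailDeriv κ L z with hu
  set U := omegaTail κ L z with hU
  have hz1 : 1 < z := by linarith
  have hw1 : 1 < w := by linarith
  have hz0 : 0 ≤ z := by linarith
  have hlogz : 0 < Real.log z := Real.log_pos hz1
  have hTz0 : 0 < Tz := hdim.vprod_pos z
  have haw : w ≤ a := Nat.le_ceil w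
  have hbz : (b : ℝ) < z + 1 := Nat.ceil_lt_add_one hz0
  have hTb : T b = Tz := by
    simp only [hT, hTz, hb]
    rw [primesProdBelow_natCast'']
    rfl
  -- nonnegativity of the integrand and of the right-hand side
  have hu0 : ∀ x, w ≤ x → 0 ≤ u x := fun x hx =>
    omegaTailDeriv_nonneg hκ hL hz1.le (by linarith)
  have hΦu_int : ∀ c d, w ≤ c → c ≤ d → d ≤ z →
      IntervalIntegrable (fun x => Φ x * u x) volume c d := by
    intro c d hc hcd hdz
    have hi := intervalIntegrable_omegaTailDeriv (κ := κ) (z := z) hκ hL hz1.le (by linarith) hcd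
    refine (hi.continuousOn_mul (hΦc.mono ?_))
    rw [uIcc_of_le hcd]
    exact Icc_subset_Icc hc hdz
  have hRHS0 : 0 ≤ Φ z * (L / Real.log z) + ∫ x in w..z, Φ x * u x := by
    have h1 : 0 ≤ Φ z * (L / Real.log z) :=
      mul_nonneg (hΦ0 z ⟨hwz, le_rfl⟩) (div_nonneg hL hlogz.le)
    have h2 : 0 ≤ ∫ x in w..z, Φ x * u x :=
      intervalIntegral.integral_nonneg hwz fun x hx => mul_nonneg (hΦ0 x hx) (hu0 x hx.1)
    linarith
  rw [sum_primes_eq_sum_Ico]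
  -- the empty case
  rcases le_or_gt b a with hba | hab
  · rw [Finset.Ico_eq_empty_of_le hba, Finset.sum_empty]
    exact mul_nonneg hTz0.le hRHS0
  -- `b = a + k + 1`
  obtain ⟨k, hk⟩ : ∃ k, b = a + k + 1 := ⟨b - a - 1, by omega⟩
  have hnz : ∀ i ≤ k, ((a + i : ℕ) : ℝ) < z := fun i hi => by
    have : ((a + i : ℕ) : ℝ) ≤ (b : ℝ) - 1 := by
      have : a + i + 1 ≤ b := by omega
      have := (Nat.cast_le (α := ℝ)).mpr this
      push_cast at this ⊢; linarith
    linarith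
  have hnw : ∀ i, w ≤ ((a + i : ℕ) : ℝ) := fun i => by
    have : (a : ℝ) ≤ ((a + i : ℕ) : ℝ) := by push_cast; linarith
    exact haw.trans this
  have hn1 : ∀ i, (1 : ℝ) < ((a + i : ℕ) : ℝ) := fun i => lt_of_lt_of_le hw1 (hnw i)
  -- reindex over `i ≤ k` and apply Abel's inequality
  rw [Finset.sum_Ico_eq_sum_range, show b - a = k + 1 by omega]
  set C : ℕ → ℝ := fun i => T (a + i) - Tz with hC
  set Uu : ℕ → ℝ := fun i => Tz * U ((a + i : ℕ) : ℝ) with hUu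
  set Ph : ℕ → ℝ := fun i => Φ ((a + i : ℕ) : ℝ) with hPh
  have hsum_eq : ∑ i ∈ range (k + 1),
      (vprod g (primesProdBelow ((a + i : ℕ) : ℝ)) -
        vprod g (primesProdBelow ((a + i + 1 : ℕ) : ℝ))) * Φ ((a + i : ℕ) : ℝ) =
      ∑ i ∈ range (k + 1), (C i - C (i + 1)) * Ph i := by
    refine Finset.sum_congr rfl fun i _ => ?_
    simp only [hC, hPh, hT, ← add_assoc]
    ring
  rw [hsum_eq]
  have hend : C (k + 1) = 0 := by
    simp only [hC]
    rw [show a + (k + 1) = b by omega, hTb, sub_self]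
  have hCU : ∀ i ≤ k, C i ≤ Uu i := by
    intro i hi
    simp only [hC, hUu, hT, hU]
    rw [omegaTail_eq hz1.le (hn1 i)]
    have hn2 : (2 : ℝ) ≤ ((a + i : ℕ) : ℝ) := hw.trans (hnw i)
    have h := hdim.vprod_le hn2 (hnz i hi).le
    nlinarith [h, hTz0]
  have hmono : ∀ i < k, Ph i ≤ Ph (i + 1) := by
    intro i hi
    simp only [hPh]
    refine hΦm ⟨hnw i, (hnz i hi.le).le⟩ ⟨hnw (i + 1), (hnz (i + 1) (by omega)).le⟩ ?_
    push_cast; linarith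
  have hPh0 : 0 ≤ Ph 0 := by
    simp only [hPh]
    exact hΦ0 _ ⟨hnw 0, (hnz 0 (Nat.zero_le k)).le⟩
  refine (Abel.sum_sub_mul_le C Uu Ph k hPh0 hmono hCU hend).trans ?_
  -- convert the Abel bound into integrals
  have hstep : ∀ i < k, Ph i * (Uu i - Uu (i + 1)) ≤
      Tz * ∫ x in ((a + i : ℕ) : ℝ)..((a + (i + 1) : ℕ) : ℝ), Φ x * u x := by
    intro i hi
    have hcd : ((a + i : ℕ) : ℝ) ≤ ((a + (i + 1) : ℕ) : ℝ) := by push_cast; linarith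
    have hdz : ((a + (i + 1) : ℕ) : ℝ) ≤ z := (hnz (i + 1) (by omega)).le
    have hftc := omegaTail_sub_eq_integral (κ := κ) (L := L) (z := z) hκ hL hz1.le (hn1 i) hcd
    simp only [hPh, hUu, hU]
    rw [← mul_sub, hftc,
      show Φ ((a + i : ℕ) : ℝ) * (Tz * ∫ x in ((a + i : ℕ) : ℝ)..((a + (i + 1) : ℕ) : ℝ),
          omegaTailDeriv κ L z x) = Tz * ∫ x in ((a + i : ℕ) : ℝ)..((a + (i + 1) : ℕ) : ℝ),
          Φ ((a + i : ℕ) : ℝ) * u x by rw [intervalIntegral.integral_const_mul]; ring]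
    refine mul_le_mul_of_nonneg_left ?_ hTz0.le
    refine intervalIntegral.integral_mono_on hcd ?_ (hΦu_int _ _ (hnw i) hcd hdz) fun x hx => ?_
    · exact (intervalIntegrable_omegaTailDeriv hκ hL hz1.le (hn1 i) hcd).const_mul _
    · exact mul_le_mul_of_nonneg_right
        (hΦm ⟨hnw i, (hnz i hi.le).le⟩ ⟨(hnw i).trans hx.1, hx.2.trans hdz⟩ hx.1)
        (hu0 x ((hnw i).trans hx.1))
  have hlast : Ph k * Uu k ≤
      Tz * (Φ z * (L / Real.log z) + ∫ x in ((a + k : ℕ) : ℝ)..z, Φ x * u x) := by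
    have hcd : ((a + k : ℕ) : ℝ) ≤ z := (hnz k le_rfl).le
    have hftc := omegaTail_sub_eq_integral (κ := κ) (L := L) (z := z) hκ hL hz1.le (hn1 k) hcd
    rw [omegaTail_self hz1] at hftc
    simp only [hPh, hUu, hU]
    have hUk : omegaTail κ L z ((a + k : ℕ) : ℝ) =
        L / Real.log z + ∫ x in ((a + k : ℕ) : ℝ)..z, u x := by
      linarith
    rw [hUk]
    have hΦk0 : 0 ≤ Φ ((a + k : ℕ) : ℝ) := hΦ0 _ ⟨hnw k, hcd⟩
    have hΦkz : Φ ((a + k : ℕ) : ℝ) ≤ Φ z := hΦm ⟨hnw k, hcd⟩ ⟨hwz, le_rfl⟩ hcd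
    have h1 : Φ ((a + k : ℕ) : ℝ) * (L / Real.log z) ≤ Φ z * (L / Real.log z) :=
      mul_le_mul_of_nonneg_right hΦkz (div_nonneg hL hlogz.le)
    have h2 : Φ ((a + k : ℕ) : ℝ) * (∫ x in ((a + k : ℕ) : ℝ)..z, u x) ≤
        ∫ x in ((a + k : ℕ) : ℝ)..z, Φ x * u x := by
      rw [← intervalIntegral.integral_const_mul]
      refine intervalIntegral.integral_mono_on hcd ?_ (hΦu_int _ _ (hnw k) hcd le_rfl)
        fun x hx => ?_
      · exact (intervalIntegrable_omegaTailDeriv hκ hL hz1.le (hn1 k) hcd).const_mul _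
      · exact mul_le_mul_of_nonneg_right (hΦm ⟨hnw k, hcd⟩ ⟨(hnw k).trans hx.1, hx.2⟩ hx.1)
          (hu0 x ((hnw k).trans hx.1))
    calc Φ ((a + k : ℕ) : ℝ) * (Tz * (L / Real.log z + ∫ x in ((a + k : ℕ) : ℝ)..z, u x))
        = Tz * (Φ ((a + k : ℕ) : ℝ) * (L / Real.log z) +
            Φ ((a + k : ℕ) : ℝ) * ∫ x in ((a + k : ℕ) : ℝ)..z, u x) := by ring
      _ ≤ Tz * (Φ z * (L / Real.log z) + ∫ x in ((a + k : ℕ) : ℝ)..z, Φ x * u x) :=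
        mul_le_mul_of_nonneg_left (add_le_add h1 h2) hTz0.le
  -- sum the adjacent integrals
  have hadj : ∑ i ∈ range k, ∫ x in ((a + i : ℕ) : ℝ)..((a + (i + 1) : ℕ) : ℝ), Φ x * u x =
      ∫ x in ((a + 0 : ℕ) : ℝ)..((a + k : ℕ) : ℝ), Φ x * u x := by
    refine intervalIntegral.sum_integral_adjacent_intervals (a := fun i => ((a + i : ℕ) : ℝ)) ?_
    intro i hi
    exact hΦu_int _ _ (hnw i) (by push_cast; linarith) (hnz (i + 1) (by omega)).le
  calc ∑ i ∈ range k, Ph i * (Uu i - Uu (i + 1)) + Ph k * Uu k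
      ≤ ∑ i ∈ range k, (Tz * ∫ x in ((a + i : ℕ) : ℝ)..((a + (i + 1) : ℕ) : ℝ), Φ x * u x) +
          Tz * (Φ z * (L / Real.log z) + ∫ x in ((a + k : ℕ) : ℝ)..z, Φ x * u x) :=
        add_le_add (Finset.sum_le_sum fun i hi => hstep i (mem_range.mp hi)) hlast
    _ = Tz * (Φ z * (L / Real.log z) + ∫ x in ((a + 0 : ℕ) : ℝ)..z, Φ x * u x) := by
        rw [← Finset.mul_sum, hadj, ← intervalIntegral.integral_add_adjacent_intervals
          (hΦu_int _ _ (hnw 0) (by push_cast; linarith) (hnz k le_rfl).le)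
          (hΦu_int _ _ (hnw k) (hnz k le_rfl).le le_rfl)]
        ring
    _ ≤ Tz * (Φ z * (L / Real.log z) + ∫ x in w..z, Φ x * u x) := by
        refine mul_le_mul_of_nonneg_left (add_le_add_right ?_ _) hTz0.le
        refine intervalIntegral.integral_mono_interval (hnw 0) (hnz 0 (Nat.zero_le k)).le le_rfl
          ?_ (hΦu_int _ _ le_rfl hwz le_rfl)
        refine (ae_restrict_mem measurableSet_Ioc).mono fun x hx => ?_
        exact mul_nonneg (hΦ0 x ⟨hx.1.le, hx.2⟩) (hu0 x hx.1.le)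

/-- Pointwise form of the weighted derivative against `(log x/log z)^κ`:
`(log x/log z)^κ B u(x) = B (κ/(x log x) + (κ + 1) L/(x log² x))` (`x > 1`, `z > 1`). [folklore] -/
theorem rpow_mul_omegaTailDeriv_eq {κ L z x : ℝ} (hz : 1 < z) (hx : 1 < x) (B : ℝ) :
    (Real.log x / Real.log z) ^ κ * B * omegaTailDeriv κ L z x =
      B * (κ / (x * Real.log x) + (κ + 1) * L / (x * Real.log x ^ 2)) := by
  have hr : 0 < Real.log x := Real.log_pos hx
  have hR : 0 < Real.log z := Real.log_pos hz
  have hx0 : x ≠ 0 := by positivity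
  have e1 : Real.log x ^ κ * Real.log x ^ (-κ - 1) = (Real.log x)⁻¹ := by
    rw [← Real.rpow_add hr, show κ + (-κ - 1) = -1 by ring, Real.rpow_neg_one]
  have e2 : Real.log x ^ κ * Real.log x ^ (-κ - 2) = (Real.log x ^ 2)⁻¹ := by
    rw [← Real.rpow_add hr, show κ + (-κ - 2) = -(2 : ℝ) by ring, Real.rpow_neg hr.le,
      Real.rpow_two]
  have e3 : (Real.log z ^ κ)⁻¹ * Real.log z ^ κ = 1 :=
    inv_mul_cancel₀ (Real.rpow_pos_of_pos hR κ).ne'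
  rw [omegaTailDeriv, Real.div_rpow hr.le hR.le]
  calc Real.log x ^ κ / Real.log z ^ κ * B *
        (Real.log z ^ κ * (κ * Real.log x ^ (-κ - 1) + (κ + 1) * L * Real.log x ^ (-κ - 2)) / x)
      = B * ((Real.log z ^ κ)⁻¹ * Real.log z ^ κ) *
          (κ * (Real.log x ^ κ * Real.log x ^ (-κ - 1)) +
            (κ + 1) * L * (Real.log x ^ κ * Real.log x ^ (-κ - 2))) / x := by ring
    _ = B * (κ / (x * Real.log x) + (κ + 1) * L / (x * Real.log x ^ 2)) := by
        rw [e1, e2, e3]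
        field_simp

/-- `x ↦ x (log x)^n` is continuous on `[w, z]`, `w > 0`. [folklore] -/
theorem continuousOn_mul_log_pow (n : ℕ) {w z : ℝ} (hw : 0 < w) :
    ContinuousOn (fun x : ℝ => x * Real.log x ^ n) (Icc w z) :=
  continuousOn_id.mul ((Real.continuousOn_log.mono fun _ hx => ne_of_gt (hw.trans_le hx.1)).pow n)

/-- `x (log x)^n ≠ 0` for `x ≥ w > 1`. [folklore] -/
theorem mul_log_pow_ne_zero (n : ℕ) {w x : ℝ} (hw : 1 < w) (hx : w ≤ x) :
    x * Real.log x ^ n ≠ 0 :=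
  mul_ne_zero (ne_of_gt (by linarith)) (pow_ne_zero n (Real.log_pos (hw.trans_le hx)).ne')

/-- `x ↦ B(x)/(x (log x)^n)` is continuous on `[w, z]` when `B` is, `w > 1`. [folklore] -/
theorem continuousOn_div_mul_log_pow {B : ℝ → ℝ} {w z : ℝ} (hBc : ContinuousOn B (Icc w z))
    (hw : 1 < w) (n : ℕ) : ContinuousOn (fun x => B x / (x * Real.log x ^ n)) (Icc w z) :=
  hBc.div (continuousOn_mul_log_pow n (by linarith)) fun _ hx => mul_log_pow_ne_zero n hw hx.1

/-- **Iwaniec's Lemma 21** (*Rosser's sieve*, Acta Arith. 36 (1980), (8.2); "follows immediately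
from (1.3) by partial summation"; = Greaves, *Sieves in Number Theory*, Lemma 4.1.2(ii) with
`H(t) = (s/t)^κ B(x)`, `t = log y/log x`). Let `g` satisfy `Ω(κ, L)` (`κ ≥ 0`; Iwaniec's (1.3) with
`K = L`), `2 ≤ w ≤ z`, and let `B` be nonnegative, continuous and non-decreasing on `[w, z]`
(Iwaniec: positive, continuous, increasing). Then
`∑_{w ≤ p < z} g(p) V(P(p)) (log p/log z)^κ B(p)`
`  ≤ V(P(z)) (κ ∫_w^z B(x) dx/(x log x) + (κ + 1) L ∫_w^z B(x) dx/(x log² x) + B(z) L/log z)`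
(the bound obtained in the proof; Iwaniec's displayed form, with the last two terms majorised by
`(κ + 1) L B(z)/log w`, is `sum_primes_rpow_mul_le'`). In Iwaniec's normalisation the left side is
`V(z) ∑ (ω(p)/p)(V(p)/V(z)) (log p/log z)^κ B(p)`. [cite: IwaniecActaArith1980, Lemma 21 (8.2)] -/
theorem sum_primes_rpow_mul_le (hdim : HasIwaniecDimension g κ L) (hκ : 0 ≤ κ) {w z : ℝ}
    (hw : 2 ≤ w) (hwz : w ≤ z) {B : ℝ → ℝ} (hB0 : ∀ x ∈ Icc w z, 0 ≤ B x)
    (hBm : MonotoneOn B (Icc w z)) (hBc : ContinuousOn B (Icc w z)) :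
    ∑ p ∈ Nat.primesBelow ⌈z⌉₊ with w ≤ ((p : ℕ) : ℝ),
        g p * vprod g (primesProdBelow p) * ((Real.log p / Real.log z) ^ κ * B p) ≤
      vprod g (primesProdBelow z) *
        (κ * (∫ x in w..z, B x / (x * Real.log x)) +
          (κ + 1) * L * (∫ x in w..z, B x / (x * Real.log x ^ 2)) + B z * (L / Real.log z)) := by
  have hL : 0 ≤ L := hdim.nonneg
  have hz1 : 1 < z := by linarith
  have hw1 : 1 < w := by linarith
  have hlogz : 0 < Real.log z := Real.log_pos hz1
  have hTz0 : 0 < vprod g (primesProdBelow z) := hdim.vprod_pos z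
  -- the weight `Φ(x) = (log x/log z)^κ B(x)`
  set Φ : ℝ → ℝ := fun x => (Real.log x / Real.log z) ^ κ * B x with hΦ
  have hbase : ∀ x ∈ Icc w z, 0 ≤ Real.log x / Real.log z := fun x hx =>
    div_nonneg (Real.log_nonneg (by linarith [hx.1])) hlogz.le
  have hΦ0 : ∀ x ∈ Icc w z, 0 ≤ Φ x := fun x hx =>
    mul_nonneg (Real.rpow_nonneg (hbase x hx) κ) (hB0 x hx)
  have hΦm : MonotoneOn Φ (Icc w z) := by
    intro x hx y hy hxy
    simp only [hΦ]
    refine mul_le_mul ?_ (hBm hx hy hxy) (hB0 x hx) (Real.rpow_nonneg (hbase y hy) κ)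
    refine Real.rpow_le_rpow (hbase x hx) ?_ hκ
    exact div_le_div_of_nonneg_right (Real.log_le_log (by linarith [hx.1]) hxy) hlogz.le
  have hlogc : ContinuousOn (fun x => Real.log x / Real.log z) (Icc w z) :=
    (Real.continuousOn_log.mono fun x hx => ne_of_gt (by linarith [hx.1] : (0 : ℝ) < x)).div_const _
  have hΦc : ContinuousOn Φ (Icc w z) :=
    (hlogc.rpow_const fun x _ => Or.inr hκ).mul hBc
  have key := sum_primes_le_of_monotoneOn hdim hκ hw hwz hΦ0 hΦm hΦc
  have hΦz : Φ z = B z := by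
    simp only [hΦ]; rw [div_self hlogz.ne', Real.one_rpow, one_mul]
  -- the integrand
  have hint_eq : ∫ x in w..z, Φ x * omegaTailDeriv κ L z x =
      ∫ x in w..z, B x * (κ / (x * Real.log x) + (κ + 1) * L / (x * Real.log x ^ 2)) := by
    refine intervalIntegral.integral_congr fun x hx => ?_
    rw [uIcc_of_le hwz] at hx
    simp only [hΦ]
    exact rpow_mul_omegaTailDeriv_eq hz1 (by linarith [hx.1]) (B x)
  have hc1 : ContinuousOn (fun x => B x / (x * Real.log x)) (uIcc w z) := by
    rw [uIcc_of_le hwz]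
    have := continuousOn_div_mul_log_pow hBc hw1 1
    simpa only [pow_one] using this
  have hc2 : ContinuousOn (fun x => B x / (x * Real.log x ^ 2)) (uIcc w z) := by
    rw [uIcc_of_le hwz]
    exact continuousOn_div_mul_log_pow hBc hw1 2
  have hsplit : ∫ x in w..z, B x * (κ / (x * Real.log x) + (κ + 1) * L / (x * Real.log x ^ 2)) =
      κ * (∫ x in w..z, B x / (x * Real.log x)) +
        (κ + 1) * L * (∫ x in w..z, B x / (x * Real.log x ^ 2)) := by
    rw [← intervalIntegral.integral_const_mul, ← intervalIntegral.integral_const_mul,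
      ← intervalIntegral.integral_add (hc1.intervalIntegrable.const_mul κ)
        (hc2.intervalIntegrable.const_mul _)]
    refine intervalIntegral.integral_congr fun x _ => ?_
    ring
  calc ∑ p ∈ Nat.primesBelow ⌈z⌉₊ with w ≤ ((p : ℕ) : ℝ),
        g p * vprod g (primesProdBelow p) * ((Real.log p / Real.log z) ^ κ * B p)
      = ∑ p ∈ Nat.primesBelow ⌈z⌉₊ with w ≤ ((p : ℕ) : ℝ),
          g p * vprod g (primesProdBelow p) * Φ p := by simp only [hΦ]
    _ ≤ _ := key
    _ = _ := by rw [hΦz, hint_eq, hsplit]; ring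

/-- `∫_w^z dx/(x log² x) = 1/log w − 1/log z` (`1 < w ≤ z`). [folklore] -/
theorem integral_inv_mul_log_sq {w z : ℝ} (hw : 1 < w) (hwz : w ≤ z) :
    ∫ x in w..z, (x * Real.log x ^ 2)⁻¹ = (Real.log w)⁻¹ - (Real.log z)⁻¹ := by
  have hderiv : ∀ x ∈ Ioo w z, HasDerivAt (fun y => -Real.log y ^ (-1 : ℝ))
      ((x * Real.log x ^ 2)⁻¹) x := by
    intro x hx
    have hx1 : 1 < x := hw.trans hx.1
    have hx0 : x ≠ 0 := by positivity
    have hlog : 0 < Real.log x := Real.log_pos hx1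
    have h := ((Real.hasDerivAt_log hx0).rpow_const (p := (-1 : ℝ)) (Or.inl hlog.ne')).neg
    refine h.congr_deriv ?_
    rw [show (-1 - 1 : ℝ) = -(2 : ℝ) by norm_num, Real.rpow_neg hlog.le, Real.rpow_two]
    field_simp
  have hcont : ContinuousOn (fun y => -Real.log y ^ (-1 : ℝ)) (Icc w z) := by
    refine ((Real.continuousOn_log.mono fun x hx => ?_).rpow_const fun x hx => Or.inl ?_).neg
    · exact ne_of_gt (by linarith [hx.1] : (0 : ℝ) < x)
    · exact (Real.log_pos (by linarith [hx.1])).ne'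
  have hint : IntervalIntegrable (fun x => (x * Real.log x ^ 2)⁻¹) volume w z := by
    refine ContinuousOn.intervalIntegrable ?_
    rw [uIcc_of_le hwz]
    exact (continuousOn_mul_log_pow 2 (by linarith)).inv₀ fun _ hx => mul_log_pow_ne_zero 2 hw hx.1
  rw [integral_eq_sub_of_hasDerivAt_of_le hwz hcont hderiv hint, Real.rpow_neg_one,
    Real.rpow_neg_one]
  ring

/-- **Iwaniec's Lemma 21, displayed form (8.2)**: under the hypotheses of `sum_primes_rpow_mul_le`,
`∑_{w ≤ p < z} g(p) V(P(p)) (log p/log z)^κ B(p)`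
`  ≤ V(P(z)) (κ ∫_w^z B(x) d log log x + B(z)(κ + 1)K/log w)` with `K = L`
(`d log log x = dx/(x log x)`; from `sum_primes_rpow_mul_le` by `B(x) ≤ B(z)`,
`∫_w^z dx/(x log² x) = 1/log w − 1/log z` and `κ ≥ 0`).
[cite: IwaniecActaArith1980, Lemma 21 (8.2)] -/
theorem sum_primes_rpow_mul_le' (hdim : HasIwaniecDimension g κ L) (hκ : 0 ≤ κ) {w z : ℝ}
    (hw : 2 ≤ w) (hwz : w ≤ z) {B : ℝ → ℝ} (hB0 : ∀ x ∈ Icc w z, 0 ≤ B x)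
    (hBm : MonotoneOn B (Icc w z)) (hBc : ContinuousOn B (Icc w z)) :
    ∑ p ∈ Nat.primesBelow ⌈z⌉₊ with w ≤ ((p : ℕ) : ℝ),
        g p * vprod g (primesProdBelow p) * ((Real.log p / Real.log z) ^ κ * B p) ≤
      vprod g (primesProdBelow z) *
        (κ * (∫ x in w..z, B x / (x * Real.log x)) + B z * ((κ + 1) * L / Real.log w)) := by
  have hL : 0 ≤ L := hdim.nonneg
  have hz1 : 1 < z := by linarith
  have hw1 : 1 < w := by linarith
  have hlogz : 0 < Real.log z := Real.log_pos hz1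
  have hlogw : 0 < Real.log w := Real.log_pos hw1
  have hTz0 : 0 < vprod g (primesProdBelow z) := hdim.vprod_pos z
  refine (sum_primes_rpow_mul_le hdim hκ hw hwz hB0 hBm hBc).trans
    (mul_le_mul_of_nonneg_left ?_ hTz0.le)
  have hBz : 0 ≤ B z := hB0 z ⟨hwz, le_rfl⟩
  -- `∫ B/(x log²x) ≤ B(z) (1/log w − 1/log z)`
  have hI : ∫ x in w..z, B x / (x * Real.log x ^ 2) ≤ B z * ((Real.log w)⁻¹ - (Real.log z)⁻¹) := by
    rw [← integral_inv_mul_log_sq hw1 hwz, ← intervalIntegral.integral_const_mul]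
    have hc : ContinuousOn (fun x => (x * Real.log x ^ 2)⁻¹) (uIcc w z) := by
      rw [uIcc_of_le hwz]
      exact (continuousOn_mul_log_pow 2 (by linarith)).inv₀ fun _ hx =>
        mul_log_pow_ne_zero 2 hw1 hx.1
    have hc' : ContinuousOn (fun x => B x / (x * Real.log x ^ 2)) (uIcc w z) := by
      rw [uIcc_of_le hwz]
      exact continuousOn_div_mul_log_pow hBc hw1 2
    refine intervalIntegral.integral_mono_on hwz hc'.intervalIntegrable
      (hc.intervalIntegrable.const_mul _) fun x hx => ?_
    have hpos : 0 < x * Real.log x ^ 2 :=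
      mul_pos (by linarith [hx.1]) (pow_pos (Real.log_pos (by linarith [hx.1])) 2)
    rw [div_eq_mul_inv]
    exact mul_le_mul_of_nonneg_right (hBm ⟨hx.1, hx.2⟩ ⟨hwz, le_rfl⟩ hx.2) (inv_nonneg.mpr hpos.le)
  have h1 : (κ + 1) * L * (∫ x in w..z, B x / (x * Real.log x ^ 2)) ≤
      (κ + 1) * L * (B z * ((Real.log w)⁻¹ - (Real.log z)⁻¹)) :=
    mul_le_mul_of_nonneg_left hI (by positivity)
  have h2 : B z * (L / Real.log z) ≤ B z * ((κ + 1) * L * (Real.log z)⁻¹) := by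
    refine mul_le_mul_of_nonneg_left ?_ hBz
    rw [div_eq_mul_inv]
    have : 0 ≤ κ * L * (Real.log z)⁻¹ := by positivity
    nlinarith
  calc κ * (∫ x in w..z, B x / (x * Real.log x)) +
        (κ + 1) * L * (∫ x in w..z, B x / (x * Real.log x ^ 2)) + B z * (L / Real.log z)
      ≤ κ * (∫ x in w..z, B x / (x * Real.log x)) +
          (κ + 1) * L * (B z * ((Real.log w)⁻¹ - (Real.log z)⁻¹)) +
          B z * ((κ + 1) * L * (Real.log z)⁻¹) := by linarith
    _ = κ * (∫ x in w..z, B x / (x * Real.log x)) + B z * ((κ + 1) * L / Real.log w) := by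
        rw [div_eq_mul_inv]; ring

end BetaSieve

end Literature.NumberTheory.Sieve
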